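import Mathlib
import HarnessLib.Audit
import Summits.PneNP.PneNP.Theorems.PstarChordReadSlackOne

/-!
# Slack two: four slice-generic chords kill a terminal core with `2·#bdry J₀ ≤ 3·#J₀ + 2` (ROUND-24, O1 at fourteen outputs; memo g22 §24)

FRONTIER range-avoidance ladder, rung F-N3, ROUND 24 (cell `pnp-ideate`, prover-2 memo `g22/O1-PAIRCORE-g22.md` §20, §24; typed target
`PstarCoreBoundTargets.TerminalPeelable` (p646951); restricted-model proof complexity — nothing here bears on `P` versus `NP`).

A fourteen-output terminal core with a centre cycle has boundary slack two (`#bdry ≤ 22`).  At slack two the boundary count no longer forbids a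
SHARED PARTNER (a hub `{vₐ, z}, {v_b, z}` costs exactly two) nor two INSIDE PARTNERS, but it forbids every combination of three defects.  The
counts (`PstarChordReadSlackOne.card_bdry_insert_le_of_inside`, `PstarChordReadTight.card_bdry_insert_le_gen`, iterated over three or four
inserted monomials):

* `outsideGated_of_three` (F1) — of three distinct chords at least one is outside-gated;
* `outsideGated_of_shared` (F2) — if two chords share a partner, every third chord is outside-gated;
* `no_three_on_partner` (F3′) — no outside variable is a partner of three distinct chords;
* `no_two_sharing_pairs` (F3) — no two disjoint pairs of chords with shared partners;
* sequel `PstarChordReadSlackTwoFour`: FOUR distinct slice-generic chords kill a terminal core of slack two, and O1 for cores of at most fourteen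
  outputs modulo (H₁₂), (H₁₃), (H₁₄).

(The affordable sharing graphs at slack two are stars and triangles — every two sharing edges meet; the pure hub theorem `PstarChordReadHub` is
the first step towards THREE generic chords.)  No Assumption A.
-/

set_option linter.dupNamespace false -- `Summit.PneNP.PneNP.…`: summit = sub-problem name (D-0017 single-conjunct layout)

open Finset Literature.Computability.Complexity
open Summit.PneNP.PneNP.Theorems.PstarTyped (Typed)
open Summit.PneNP.PneNP.Theorems.PstarSALevel (varSet bdry BoundaryExpanding SimpleOverlap)
open Summit.PneNP.PneNP.Theorems.PstarGapPeeling (not_mem_varSet_of_private)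
open Summit.PneNP.PneNP.Theorems.PstarCentreFree (vars_mem_varSet)
open Summit.PneNP.PneNP.Theorems.PstarCoreBound (XorClosed)
open Summit.PneNP.PneNP.Theorems.PstarXCore (xverts)
open Summit.PneNP.PneNP.Theorems.PstarChordRepair (IsChord)
open Summit.PneNP.PneNP.Theorems.PstarCoreBoundTargets (Terminal nonchords)
open Summit.PneNP.PneNP.Theorems.PstarSharingBound (sharedSlots card_bdry_add_card_sharedSlots_le)
open Summit.PneNP.PneNP.Theorems.PstarChordBridgeTools (xpdeg)
open Summit.PneNP.PneNP.Theorems.PstarChordBridgeCotree (Peelable)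
open Summit.PneNP.PneNP.Theorems.PstarMaxSharingReaders (exists_mem_of_mem_bdry)
open Summit.PneNP.PneNP.Theorems.PstarGateUnit (mem_bdry_of_unique)
open Summit.PneNP.PneNP.Theorems.PstarChordReadLemma (SliceGeneric)
open Summit.PneNP.PneNP.Theorems.PstarChordReadOutside (IsGate OutsideGated Partner)
open Summit.PneNP.PneNP.Theorems.PstarChordReadTwoChords (false_of_two_gated)
open Summit.PneNP.PneNP.Theorems.PstarChordReadTight (card_bdry_insert_le_gen not_mem_and_card)
open Summit.PneNP.PneNP.Theorems.PstarTerminalPeelableTwelve (twelve_le_two_mul_card_sharedSlots exists_centre_of_not_peelable)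
open Summit.PneNP.PneNP.Theorems.PstarChordReadSlackOne (exists_inside_partner mem_varSet_of_pair card_bdry_insert_le_of_inside
  mem_bdry_insert_of_not_mem peelable_of_card_le_thirteen)

namespace Summit.PneNP.PneNP.Theorems.PstarChordReadSlackTwo

variable {n m : ℕ}

/-! ## Bookkeeping -/
section Tools

variable {I : LocalMap 4 n m} {r : ℕ} {y : Fin m → Bool} {J₀ : Finset (Fin m)} {w₁ w₂ : Finset (Fin n) × Finset (Fin m) × Bool}

/-- In a typed instance an AND variable `v'` (of any output `c`) is a variable of a monomial `g` with AND pair `{a, b}` only if it is `a` or `b`. -/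
theorem priv_not_mem_varSet (hT : Typed I) {g c : Fin m} {a b v' : Fin n}
    (hpair : (I.vars g 2 = a ∧ I.vars g 3 = b) ∨ (I.vars g 2 = b ∧ I.vars g 3 = a)) (hv' : v' = I.vars c 2 ∨ v' = I.vars c 3)
    (ha : v' ≠ a) (hb : v' ≠ b) : v' ∉ varSet I g := by
  intro h
  unfold PstarSALevel.varSet at h
  obtain ⟨s, -, hs⟩ := mem_image.1 h
  obtain ⟨t, ht2, htv⟩ : ∃ t : Fin 4, 2 ≤ t.val ∧ I.vars c t = v' := by
    rcases hv' with e | e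
    exacts [⟨2, by decide, e.symm⟩, ⟨3, by decide, e.symm⟩]
  have h4 : ∀ u : Fin 4, u = 0 ∨ u = 1 ∨ u = 2 ∨ u = 3 := by decide
  rcases h4 s with rfl | rfl | rfl | rfl
  · exact hT g c 0 t (by decide) ht2 (hs.trans htv.symm)
  · exact hT g c 1 t (by decide) ht2 (hs.trans htv.symm)
  · rcases hpair with ⟨h2, -⟩ | ⟨h2, -⟩
    · exact ha (hs.symm.trans h2)
    · exact hb (hs.symm.trans h2)
  · rcases hpair with ⟨-, h3⟩ | ⟨-, h3⟩
    · exact hb (hs.symm.trans h3)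
    · exact ha (hs.symm.trans h3)

/-- A private of a chord: in its `varSet` and on the boundary. -/
theorem priv_mem {c : Fin m} {v : Fin n} (hch : IsChord I J₀ c) (hv : v = I.vars c 2 ∨ v = I.vars c 3) : v ∈ varSet I c ∧ v ∈ bdry I J₀ := by
  rcases hv with e | e <;> rw [e]
  exacts [⟨vars_mem_varSet I c 2, hch.1⟩, ⟨vars_mem_varSet I c 3, hch.2⟩]

/-- Privates of distinct chords are distinct. -/
theorem priv_ne {c c' : Fin m} {v v' : Fin n} (hc : c ∈ J₀) (hc' : c' ∈ J₀) (hne : c ≠ c') (hch : IsChord I J₀ c) (hch' : IsChord I J₀ c')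
    (hv : v = I.vars c 2 ∨ v = I.vars c 3) (hv' : v' = I.vars c' 2 ∨ v' = I.vars c' 3) : v ≠ v' := fun e =>
  not_mem_varSet_of_private I hc hc' hne.symm (priv_mem hch hv).2 (priv_mem hch hv).1 (e ▸ (priv_mem hch' hv').1)

/-- Menu monomials lie in `J₀ ∪ G₁ ∪ G₂`. -/
theorem mem_U {g : Fin m} (hg : g ∈ w₁.2.1 ∪ w₂.2.1) : g ∈ J₀ ∪ w₁.2.1 ∪ w₂.2.1 := by
  rcases mem_union.1 hg with h | h
  exacts [mem_union_left _ (mem_union_right _ h), mem_union_right _ h]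

/-- `insert g X ⊆ U` bookkeeping. -/
theorem insert_sub_U {X : Finset (Fin m)} {g : Fin m} (hg : g ∈ w₁.2.1 ∪ w₂.2.1) (hX : X ⊆ J₀ ∪ w₁.2.1 ∪ w₂.2.1) :
    insert g X ⊆ J₀ ∪ w₁.2.1 ∪ w₂.2.1 :=
  insert_subset_iff.2 ⟨mem_U hg, hX⟩

/-- `J₀ ⊆ U`. -/
theorem J_sub_U : J₀ ⊆ J₀ ∪ w₁.2.1 ∪ w₂.2.1 := fun _ hj => mem_union_left _ (mem_union_left _ hj)

/-- **An inside partner's second variable is off the boundary** at slack two (else one insert breaks expansion). -/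
theorem not_mem_bdry_of_inside (hI : I.IsPure xorAndPred) (hB : BoundaryExpanding r I) (ht : Terminal I r y J₀ w₁ w₂)
    (hslack : 2 * (bdry I J₀).card ≤ 3 * J₀.card + 2) {g : Fin m} (hg : g ∈ w₁.2.1 ∪ w₂.2.1) {v w : Fin n}
    (hpair : (I.vars g 2 = v ∧ I.vars g 3 = w) ∨ (I.vars g 2 = w ∧ I.vars g 3 = v)) (hv : v ∈ bdry I J₀) (hw : ∃ j ∈ J₀, w ∈ varSet I j) :
    w ∉ bdry I J₀ := by
  classical
  intro hwb
  obtain ⟨hgJ, -⟩ := not_mem_and_card ht hg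
  have hexp := hB _ ((card_le_card (insert_sub_U hg J_sub_U)).trans ht.2.2.2.2.2.1)
  rw [card_insert_of_notMem hgJ] at hexp
  have := (card_bdry_insert_le_of_inside hI hgJ hpair hv hw).2 hwb
  omega

/-- A fresh partner `z` of an inserted gate `g` is a boundary variable of `insert g X` if no member of `X` reads it. -/
theorem partner_mem_bdry_insert {X : Finset (Fin m)} {g : Fin m} {z : Fin n} (hzg : z ∈ varSet I g) (hX : ∀ j ∈ X, z ∉ varSet I j) :
    z ∈ bdry I (insert g X) :=
  mem_bdry_of_unique I (mem_insert_self g X) hzg fun j' hj' hzj' => by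
    rcases mem_insert.1 hj' with rfl | hj'
    · rfl
    · exact absurd hzj' (hX j' hj')

end Tools

/-! ## The four counts -/
section Counts

variable {I : LocalMap 4 n m} {r : ℕ} {y : Fin m → Bool} {J₀ : Finset (Fin m)} {w₁ w₂ : Finset (Fin n) × Finset (Fin m) × Bool}

/-- **(F1) At slack two, of three distinct chords at least one is outside-gated.** -/
theorem outsideGated_of_three (hI : I.IsPure xorAndPred) (hT : Typed I) (hB : BoundaryExpanding r I) (ht : Terminal I r y J₀ w₁ w₂)
    (hslack : 2 * (bdry I J₀).card ≤ 3 * J₀.card + 2) {c₁ c₂ c₃ : Fin m} (hc₁ : c₁ ∈ J₀) (hc₂ : c₂ ∈ J₀) (hc₃ : c₃ ∈ J₀) (h₁₂ : c₁ ≠ c₂)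
    (h₁₃ : c₁ ≠ c₃) (h₂₃ : c₂ ≠ c₃) (hch₁ : IsChord I J₀ c₁) (hch₂ : IsChord I J₀ c₂) (hch₃ : IsChord I J₀ c₃) :
    OutsideGated I J₀ (w₁.2.1 ∪ w₂.2.1) c₁ ∨ OutsideGated I J₀ (w₁.2.1 ∪ w₂.2.1) c₂ ∨ OutsideGated I J₀ (w₁.2.1 ∪ w₂.2.1) c₃ := by
  classical
  by_contra hno
  simp only [not_or] at hno
  obtain ⟨hn₁, hn₂, hn₃⟩ := hno
  obtain ⟨g₁, hg₁, v₁, u₁, hv₁, hp₁, hu₁⟩ := exists_inside_partner hn₁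
  obtain ⟨g₂, hg₂, v₂, u₂, hv₂, hp₂, hu₂⟩ := exists_inside_partner hn₂
  obtain ⟨g₃, hg₃, v₃, u₃, hv₃, hp₃, hu₃⟩ := exists_inside_partner hn₃
  obtain ⟨hg₁J, -⟩ := not_mem_and_card ht hg₁
  obtain ⟨hg₂J, -⟩ := not_mem_and_card ht hg₂
  obtain ⟨hg₃J, -⟩ := not_mem_and_card ht hg₃
  have hb₁ := (priv_mem hch₁ hv₁).2
  have hb₂ := (priv_mem hch₂ hv₂).2
  have hb₃ := (priv_mem hch₃ hv₃).2
  have hu₁b := not_mem_bdry_of_inside hI hB ht hslack hg₁ hp₁ hb₁ hu₁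
  have hu₂b := not_mem_bdry_of_inside hI hB ht hslack hg₂ hp₂ hb₂ hu₂
  -- privates of the later chords are not read by the earlier monomials
  have hv₂g₁ : v₂ ∉ varSet I g₁ :=
    priv_not_mem_varSet hT hp₁ hv₂ (priv_ne hc₁ hc₂ h₁₂ hch₁ hch₂ hv₁ hv₂).symm (fun e => hu₁b (e ▸ hb₂))
  have hv₃g₁ : v₃ ∉ varSet I g₁ :=
    priv_not_mem_varSet hT hp₁ hv₃ (priv_ne hc₁ hc₃ h₁₃ hch₁ hch₃ hv₁ hv₃).symm (fun e => hu₁b (e ▸ hb₃))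
  have hv₃g₂ : v₃ ∉ varSet I g₂ :=
    priv_not_mem_varSet hT hp₂ hv₃ (priv_ne hc₂ hc₃ h₂₃ hch₂ hch₃ hv₂ hv₃).symm (fun e => hu₂b (e ▸ hb₃))
  have hg₂X : g₂ ∉ insert g₁ J₀ := fun h => by
    rcases mem_insert.1 h with e | h
    · exact hv₂g₁ (e ▸ (mem_varSet_of_pair hp₂).1)
    · exact hg₂J h
  have hg₃X : g₃ ∉ insert g₂ (insert g₁ J₀) := fun h => by
    rcases mem_insert.1 h with e | h
    · exact hv₃g₂ (e ▸ (mem_varSet_of_pair hp₃).1)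
    rcases mem_insert.1 h with e | h
    · exact hv₃g₁ (e ▸ (mem_varSet_of_pair hp₃).1)
    · exact hg₃J h
  -- three inserts, each costing at most one
  have old : ∀ {X : Finset (Fin m)} {u : Fin n}, J₀ ⊆ X → (∃ j ∈ J₀, u ∈ varSet I j) → ∃ j ∈ X, u ∈ varSet I j :=
    fun hX ⟨j, hj, hu⟩ => ⟨j, hX hj, hu⟩
  have s₁ := (card_bdry_insert_le_of_inside hI hg₁J hp₁ hb₁ hu₁).1
  have s₂ := (card_bdry_insert_le_of_inside hI hg₂X hp₂ (mem_bdry_insert_of_not_mem I hb₂ hv₂g₁) (old (subset_insert _ _) hu₂)).1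
  have s₃ := (card_bdry_insert_le_of_inside hI hg₃X hp₃
    (mem_bdry_insert_of_not_mem I (mem_bdry_insert_of_not_mem I hb₃ hv₃g₁) hv₃g₂)
    (old ((subset_insert _ _).trans (subset_insert _ _)) hu₃)).1
  have hsub : insert g₃ (insert g₂ (insert g₁ J₀)) ⊆ J₀ ∪ w₁.2.1 ∪ w₂.2.1 :=
    insert_sub_U hg₃ (insert_sub_U hg₂ (insert_sub_U hg₁ J_sub_U))
  have hexp := hB _ ((card_le_card hsub).trans ht.2.2.2.2.2.1)
  rw [card_insert_of_notMem hg₃X, card_insert_of_notMem hg₂X, card_insert_of_notMem hg₁J] at hexp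
  omega

/-- **(F2) At slack two, a shared partner makes every third chord outside-gated.** -/
theorem outsideGated_of_shared (hI : I.IsPure xorAndPred) (hT : Typed I) (hB : BoundaryExpanding r I) (ht : Terminal I r y J₀ w₁ w₂)
    (hslack : 2 * (bdry I J₀).card ≤ 3 * J₀.card + 2) {cₐ c_b c : Fin m} (hcₐ : cₐ ∈ J₀) (hc_b : c_b ∈ J₀) (hc : c ∈ J₀) (hab : cₐ ≠ c_b)
    (hac : cₐ ≠ c) (hbc : c_b ≠ c) (hchₐ : IsChord I J₀ cₐ) (hch_b : IsChord I J₀ c_b) (hch : IsChord I J₀ c) {z : Fin n}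
    (hPₐ : Partner I J₀ (w₁.2.1 ∪ w₂.2.1) cₐ z) (hP_b : Partner I J₀ (w₁.2.1 ∪ w₂.2.1) c_b z) :
    OutsideGated I J₀ (w₁.2.1 ∪ w₂.2.1) c := by
  classical
  by_contra hn
  obtain ⟨gₐ, hgₐ, vₐ, hGₐ⟩ := hPₐ
  obtain ⟨g_b, hg_b, v_b, hG_b⟩ := hP_b
  obtain ⟨h, hh, v, u, hv, hp, hu⟩ := exists_inside_partner hn
  obtain ⟨hgₐJ, -⟩ := not_mem_and_card ht hgₐ
  obtain ⟨hg_bJ, -⟩ := not_mem_and_card ht hg_b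
  obtain ⟨hhJ, -⟩ := not_mem_and_card ht hh
  obtain ⟨mₐ, bₐ⟩ := priv_mem hchₐ hGₐ.1
  obtain ⟨m_b, b_b⟩ := priv_mem hch_b hG_b.1
  obtain ⟨mv, bv⟩ := priv_mem hch hv
  have hub := not_mem_bdry_of_inside hI hB ht hslack hh hp bv hu
  have hzₐ : z ∈ varSet I gₐ := (mem_varSet_of_pair hGₐ.2.1).2
  -- distinctness
  have hab' := priv_ne hcₐ hc_b hab hchₐ hch_b hGₐ.1 hG_b.1
  have hv_bz : v_b ≠ z := hG_b.ne hc_b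
  have hvz : v ≠ z := fun e => hGₐ.2.2 c hc (e ▸ mv)
  have hv_bgₐ : v_b ∉ varSet I gₐ := priv_not_mem_varSet hT hGₐ.2.1 hG_b.1 hab'.symm hv_bz
  have hvgₐ : v ∉ varSet I gₐ := priv_not_mem_varSet hT hGₐ.2.1 hv (priv_ne hcₐ hc hac hchₐ hch hGₐ.1 hv).symm hvz
  have hvg_b : v ∉ varSet I g_b := priv_not_mem_varSet hT hG_b.2.1 hv (priv_ne hc_b hc hbc hch_b hch hG_b.1 hv).symm hvz
  have hg_bX : g_b ∉ insert gₐ J₀ := fun h' => by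
    rcases mem_insert.1 h' with e | h'
    · exact hv_bgₐ (e ▸ (mem_varSet_of_pair hG_b.2.1).1)
    · exact hg_bJ h'
  have hhX : h ∉ insert g_b (insert gₐ J₀) := fun h' => by
    rcases mem_insert.1 h' with e | h'
    · exact hvg_b (e ▸ (mem_varSet_of_pair hp).1)
    rcases mem_insert.1 h' with e | h'
    · exact hvgₐ (e ▸ (mem_varSet_of_pair hp).1)
    · exact hhJ h'
  -- costs: gate `+2`, second gate on the hub `0`, inside partner `+1`
  have s₁ := card_bdry_insert_le_gen I hgₐJ (T := {vₐ}) (singleton_subset_iff.2 (mem_varSet_of_pair hGₐ.2.1).1) (singleton_subset_iff.2 bₐ)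
  rw [card_singleton] at s₁
  have hzb : z ∈ bdry I (insert gₐ J₀) := partner_mem_bdry_insert hzₐ hGₐ.2.2
  have s₂ := card_bdry_insert_le_gen I hg_bX (T := {v_b, z})
    (insert_subset_iff.2 ⟨(mem_varSet_of_pair hG_b.2.1).1, singleton_subset_iff.2 (mem_varSet_of_pair hG_b.2.1).2⟩)
    (insert_subset_iff.2 ⟨mem_bdry_insert_of_not_mem I b_b hv_bgₐ, singleton_subset_iff.2 hzb⟩)
  rw [card_pair hv_bz] at s₂
  have s₃ := (card_bdry_insert_le_of_inside hI hhX hp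
    (mem_bdry_insert_of_not_mem I (mem_bdry_insert_of_not_mem I bv hvgₐ) hvg_b)
    (by obtain ⟨j, hj, hju⟩ := hu; exact ⟨j, mem_insert_of_mem (mem_insert_of_mem hj), hju⟩)).1
  have hsub : insert h (insert g_b (insert gₐ J₀)) ⊆ J₀ ∪ w₁.2.1 ∪ w₂.2.1 :=
    insert_sub_U hh (insert_sub_U hg_b (insert_sub_U hgₐ J_sub_U))
  have hexp := hB _ ((card_le_card hsub).trans ht.2.2.2.2.2.1)
  rw [card_insert_of_notMem hhX, card_insert_of_notMem hg_bX, card_insert_of_notMem hgₐJ] at hexp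
  omega

/-- **(F3′) At slack two, no outside variable is a partner of three distinct chords.** -/
theorem no_three_on_partner (hI : I.IsPure xorAndPred) (hT : Typed I) (hB : BoundaryExpanding r I) (ht : Terminal I r y J₀ w₁ w₂)
    (hslack : 2 * (bdry I J₀).card ≤ 3 * J₀.card + 2) {cₐ c_b c_c : Fin m} (hcₐ : cₐ ∈ J₀) (hc_b : c_b ∈ J₀) (hc_c : c_c ∈ J₀)
    (hab : cₐ ≠ c_b) (hac : cₐ ≠ c_c) (hbc : c_b ≠ c_c) (hchₐ : IsChord I J₀ cₐ) (hch_b : IsChord I J₀ c_b) (hch_c : IsChord I J₀ c_c)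
    {z : Fin n} (hPₐ : Partner I J₀ (w₁.2.1 ∪ w₂.2.1) cₐ z) (hP_b : Partner I J₀ (w₁.2.1 ∪ w₂.2.1) c_b z)
    (hP_c : Partner I J₀ (w₁.2.1 ∪ w₂.2.1) c_c z) : False := by
  classical
  obtain ⟨gₐ, hgₐ, vₐ, hGₐ⟩ := hPₐ
  obtain ⟨g_b, hg_b, v_b, hG_b⟩ := hP_b
  obtain ⟨g_c, hg_c, v_c, hG_c⟩ := hP_c
  obtain ⟨hgₐJ, -⟩ := not_mem_and_card ht hgₐ
  obtain ⟨hg_bJ, -⟩ := not_mem_and_card ht hg_b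
  obtain ⟨hg_cJ, -⟩ := not_mem_and_card ht hg_c
  obtain ⟨-, bₐ⟩ := priv_mem hchₐ hGₐ.1
  obtain ⟨-, b_b⟩ := priv_mem hch_b hG_b.1
  obtain ⟨-, b_c⟩ := priv_mem hch_c hG_c.1
  have hzₐ : z ∈ varSet I gₐ := (mem_varSet_of_pair hGₐ.2.1).2
  have hv_bz : v_b ≠ z := hG_b.ne hc_b
  have hv_cz : v_c ≠ z := hG_c.ne hc_c
  have hv_bgₐ : v_b ∉ varSet I gₐ := priv_not_mem_varSet hT hGₐ.2.1 hG_b.1 (priv_ne hcₐ hc_b hab hchₐ hch_b hGₐ.1 hG_b.1).symm hv_bz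
  have hv_cgₐ : v_c ∉ varSet I gₐ := priv_not_mem_varSet hT hGₐ.2.1 hG_c.1 (priv_ne hcₐ hc_c hac hchₐ hch_c hGₐ.1 hG_c.1).symm hv_cz
  have hv_cg_b : v_c ∉ varSet I g_b :=
    priv_not_mem_varSet hT hG_b.2.1 hG_c.1 (priv_ne hc_b hc_c hbc hch_b hch_c hG_b.1 hG_c.1).symm hv_cz
  have hg_bX : g_b ∉ insert gₐ J₀ := fun h' => by
    rcases mem_insert.1 h' with e | h'
    · exact hv_bgₐ (e ▸ (mem_varSet_of_pair hG_b.2.1).1)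
    · exact hg_bJ h'
  have hg_cX : g_c ∉ insert g_b (insert gₐ J₀) := fun h' => by
    rcases mem_insert.1 h' with e | h'
    · exact hv_cg_b (e ▸ (mem_varSet_of_pair hG_c.2.1).1)
    rcases mem_insert.1 h' with e | h'
    · exact hv_cgₐ (e ▸ (mem_varSet_of_pair hG_c.2.1).1)
    · exact hg_cJ h'
  -- costs `+2`, `0`, `+1` (the third gate reads the boundary private `v_c` and the old variable `z`)
  have s₁ := card_bdry_insert_le_gen I hgₐJ (T := {vₐ}) (singleton_subset_iff.2 (mem_varSet_of_pair hGₐ.2.1).1) (singleton_subset_iff.2 bₐ)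
  rw [card_singleton] at s₁
  have hzb : z ∈ bdry I (insert gₐ J₀) := partner_mem_bdry_insert hzₐ hGₐ.2.2
  have s₂ := card_bdry_insert_le_gen I hg_bX (T := {v_b, z})
    (insert_subset_iff.2 ⟨(mem_varSet_of_pair hG_b.2.1).1, singleton_subset_iff.2 (mem_varSet_of_pair hG_b.2.1).2⟩)
    (insert_subset_iff.2 ⟨mem_bdry_insert_of_not_mem I b_b hv_bgₐ, singleton_subset_iff.2 hzb⟩)
  rw [card_pair hv_bz] at s₂
  have s₃ := (card_bdry_insert_le_of_inside hI hg_cX hG_c.2.1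
    (mem_bdry_insert_of_not_mem I (mem_bdry_insert_of_not_mem I b_c hv_cgₐ) hv_cg_b)
    ⟨gₐ, mem_insert_of_mem (mem_insert_self _ _), hzₐ⟩).1
  have hsub : insert g_c (insert g_b (insert gₐ J₀)) ⊆ J₀ ∪ w₁.2.1 ∪ w₂.2.1 :=
    insert_sub_U hg_c (insert_sub_U hg_b (insert_sub_U hgₐ J_sub_U))
  have hexp := hB _ ((card_le_card hsub).trans ht.2.2.2.2.2.1)
  rw [card_insert_of_notMem hg_cX, card_insert_of_notMem hg_bX, card_insert_of_notMem hgₐJ] at hexp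
  omega

end Counts

end Summit.PneNP.PneNP.Theorems.PstarChordReadSlackTwo
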